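import Literature.NumberTheory.EllipticCurves.ModularCurve
import Literature.NumberTheory.Automorphic.ShimuraCurveRibetTakahashiOptimalModularityProofs
import Literature.NumberTheory.EllipticCurves.ModularFormsGamma0Genus
import Literature.NumberTheory.EllipticCurves.ModularCurveGenusBoundProofs
import Literature.NumberTheory.EllipticCurves.LatticeJInvariant
import Literature.NumberTheory.EllipticCurves.SzpiroFreyConductorProofs
import Literature.NumberTheory.EllipticCurves.CongruentNumberCurveIsModular
import HarnessLib

/-!
# When is `ModularParametrizationData W N` inhabited? (carrier census, D-0034 / libB-ABC-22)

[Proofs] Theorems only, no named facts. The hypothesis structure `ModularParametrizationData W N` of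
`ModularCurve.lean` (newform `f ∈ S₂(Γ₀(N))` of `W`, Néron-type period pair, uniformisation
`ℂ →+ E(ℂ)`, integral multiplier `c Λ_f ⊆ Λ_E`, modular degree) is the carrier of 19 route items of
summit `ABC` (`∀ D : ModularParametrizationData (freyCurve a b) N, …` under
`(freyCurve a b).conductorNorm ℤ = N`). This file decides its inhabitedness as far as the tree can,
assembling existing theorems. **Verdict: inhabited at some parameters and empty at others, both
unconditionally.**

**Unconditionally.**
* `ModularParametrizationData_nonempty_congruentNumberCurve_one` — **an explicit
  inhabitant at `(E₁ : y² = x³ − x, 32)`**: `E₁` is modular with newform `η(4z)²η(8z)² ∈ S₂(Γ₀(32))`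
  (tree theorem `Tunnell1983.isNewformOf_congruentNumberCurve_one`; `N(E₁) = 32`); classically the
  identity parametrisation `X₀(32) = E₁`. As `freyCurve 1 1 = E₁`, the route's example domain is
  inhabited at `(a, b, N) = (1, 1, 32)` with `IsCoprime 1 1`, `ab(a+b) ≠ 0`, `N = N_{E_(1,1)}`
  (`ModularParametrizationData_nonempty_freyCurve_one_one_of_eq`): the `DefiniteXi` items are not
  vacuous. `ModularParametrizationData_nonempty_some` / `…_isEmpty_some` are the census' `∃`-views.
* `ModularParametrizationData.isElliptic` — a datum forces `Δ(W) ≠ 0` (`Δ(L) = g₂³ − 27g₃² ≠ 0` for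
  every period pair, `PeriodPair.discr_ne_zero`, and `g₂ = c₄/12`, `g₃ = c₆/216`); so
  `…_isEmpty_of_not_isElliptic`: **singular `W` — empty at every level**.
* `ModularParametrizationData.genusX0_ne_zero` — the newform is a non-zero element of `S₂(Γ₀(N))`, of
  dimension `g(X₀(N))` (`finrank_cuspForm_two_eq_genusX0_holds`, Diamond–Shurman Thm. 3.5.1); so
  `…_isEmpty_of_mem_genusZeroLevels`: **`N ∈ {1,…,10, 12, 13, 16, 18, 25}` — empty for every `W`**.
* `ModularParametrizationData.level_eq_level` — **at most one inhabited level per curve** (strong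
  multiplicity one across levels, Atkin–Lehner Thm. 4); that level has the prime support of `N_W`
  (`…_isEmpty_of_primeFactors_ne`) and equals `N_W` for semistable `W` (`…_isEmpty_of_squarefree_of_ne`).
* `ModularParametrizationData_nonempty_iff` — **inhabited iff `W` is elliptic and modular at level
  `N`**; `←` is the tree's construction `nonempty_modularParametrizationData_of_isNewformOf`.

**Given the modularity theorem** (the tree's named fact `exists_isNewformOf`, BCDT 2001 Thm. A as
Diamond–Shurman Thm. 8.8.3; not re-stated here): `…_nonempty_of_exists` (**every elliptic `W` at
`N = N_W`**), `…_isEmpty_of_exists_of_ne` (every other level), hence `…_nonempty_iff_of_exists`: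
`Nonempty ↔ W.IsElliptic ∧ N_W = N`. From the weaker CDT 1999 Thm. 7.1.2 (`27 ∤ N_E`):
`…_nonempty_of_CDT712` and, for Frey curves (`9 ∤ N_{E_(a,b)}`), `…_freyCurve_nonempty_of_CDT712`;
degenerate triples `ab(a+b) = 0` carry no datum (`…_freyCurve_isEmpty_of_eq_zero`).

## References

* J. B. Tunnell, Invent. Math. 72 (1983), 323–334, p. 325. [Tunnell1983Congruent]
* H. Darmon, L. Merel, J. reine angew. Math. 490 (1997), 81–100, §4, Prop. 1.1. [DarmonMerel1997]
* C. Breuil, B. Conrad, F. Diamond, R. Taylor, J. Amer. Math. Soc. 14 (2001), Thm. A; p. 845,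
  (2) ⇔ (6). [BCDTJAMS2001]
* B. Conrad, F. Diamond, R. Taylor, J. Amer. Math. Soc. 12 (1999), Thm. 7.1.2. [ConradDiamondTaylor1999]
* F. Diamond, J. Shurman, *A first course in modular forms*, GTM 228 (2005), Thm. 3.1.1, Thm. 3.5.1,
  Thm. 3.5.2, Prop. 5.8.5, (8.44), Thm. 8.8.1, Thm. 8.8.3. [DiamondShurman2005]
* A. O. L. Atkin, J. Lehner, Math. Ann. 185 (1970), Thm. 3, Thm. 4. [AtkinLehner1970]
* D. A. Cox, *Primes of the form `x² + ny²`*, 2nd ed. (2013), §10.A. [Cox2013]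
* J. H. Silverman, *The arithmetic of elliptic curves*, GTM 106 (2009), III.1 [SilvermanAEC2009];
  E. Bombieri, W. Gubler, *Heights in Diophantine geometry* (2006), Ex. 12.5.10 [BombieriGubler2006].
-/

noncomputable section

open scoped MatrixGroups ModularForm
open CongruenceSubgroup

namespace Literature.NumberTheory.EllipticCurves.ModularForms

/-! ### What a datum forces, unconditionally -/

namespace ModularParametrizationData

variable {W : WeierstrassCurve ℚ} {N : ℕ} [NeZero N]

/-- **A datum forces `Δ ≠ 0` over `ℂ`.** Its period pair `L` has `g₂(L)³ − 27 g₃(L)² ≠ 0`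
(`PeriodPair.discr_ne_zero`, Cox §10.A: `Δ(L) ≠ 0` for every lattice), and `g₂(L) = c₄/12`,
`g₃(L) = c₆/216` (`IsNeronLatticeOf`) make this `(c₄³ − c₆²)/1728 = Δ` (Silverman AEC III.1, Mathlib
`WeierstrassCurve.c_relation`). [cite: Cox2013, §10.A] [cite: SilvermanAEC2009, III.1] -/
theorem Δ_baseChange_ne_zero (D : ModularParametrizationData W N) : (W.baseChange ℂ).Δ ≠ 0 := by
  intro h0
  obtain ⟨h₂, h₃⟩ := D.isNeronLattice
  have hc : 1728 * (W.baseChange ℂ).Δ = (W.baseChange ℂ).c₄ ^ 3 - (W.baseChange ℂ).c₆ ^ 2 :=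
    (W.baseChange ℂ).c_relation
  apply D.L.discr_ne_zero
  rw [h₂, h₃]
  linear_combination (-(1 / 1728 : ℂ)) * hc + h0

/-- **A datum forces ellipticity**: `ModularParametrizationData W N → W.IsElliptic` (`Δ(W) ≠ 0` by
`Δ_baseChange_ne_zero`, `Δ` commuting with base change). [cite: SilvermanAEC2009, III.1] -/
theorem isElliptic (D : ModularParametrizationData W N) : W.IsElliptic := by
  refine ⟨isUnit_iff_ne_zero.mpr fun hΔ ↦ D.Δ_baseChange_ne_zero ?_⟩
  rw [WeierstrassCurve.baseChange, WeierstrassCurve.map_Δ, hΔ, map_zero]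

/-- **A datum forces `g(X₀(N)) ≠ 0`**: its newform is a non-zero (`a₁ = 1`) element of the
finite-dimensional space `S₂(Γ₀(N))`, of dimension `g(X₀(N))` (`finrank_cuspForm_two_eq_genusX0_holds`,
a theorem of the tree; Diamond–Shurman Thm. 3.5.1). [cite: DiamondShurman2005, Thm. 3.5.1] -/
theorem genusX0_ne_zero (D : ModularParametrizationData W N) : genusX0 N ≠ 0 := by
  intro hg
  have h : Module.finrank ℂ (CuspForm (Gamma0 N) 2) = genusX0 N :=
    finrank_cuspForm_two_eq_genusX0_holds N
  haveI := finiteDimensional_cuspForm_gamma0 N 2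
  exact D.isNewformOf.1.ne_zero (finrank_zero_iff_forall_zero.mp (h.trans hg) D.f)

/-- **At most one level per curve.** Data of the same `W` at levels `N` and `N'` force `N = N'`
(both newforms have the Hecke eigenvalues `a_p(W)`: strong multiplicity one across levels,
`IsNewformOf.level_eq_level`, a theorem of the tree). [cite: AtkinLehner1970, Thm. 4] -/
theorem level_eq_level {N' : ℕ} [NeZero N'] (D : ModularParametrizationData W N)
    (D' : ModularParametrizationData W N') : N = N' :=
  D.isNewformOf.level_eq_level D'.isNewformOf

/-- **The level of a datum has the prime support of the conductor**: `N.primeFactors = N_W.primeFactors`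
(`IsNewformOf.primeFactors_level_eq`: compare `a_{p²} = a_p² − 𝟙(p) p` on both sides;
Diamond–Shurman Prop. 5.8.5 and (8.44)). [cite: DiamondShurman2005, Prop. 5.8.5 and (8.44)] -/
theorem primeFactors_level_eq (D : ModularParametrizationData W N) :
    N.primeFactors = (W.conductorNorm ℤ).primeFactors := by
  haveI := D.isElliptic
  exact D.isNewformOf.primeFactors_level_eq

/-- **For a semistable curve the level of a datum is the conductor** (squarefree `N_W`; the case of
Carayol's theorem decided by the Fourier coefficients, `IsNewformOf.level_eq_conductorNorm_of_squarefree`;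
Atkin–Lehner 1970 Thm. 3 with Diamond–Shurman (8.44)). [cite: AtkinLehner1970, Thm. 3] -/
theorem level_eq_conductorNorm_of_squarefree (D : ModularParametrizationData W N)
    (hsq : Squarefree (W.conductorNorm ℤ)) : N = W.conductorNorm ℤ := by
  haveI := D.isElliptic
  exact D.isNewformOf.level_eq_conductorNorm_of_squarefree hsq

/-- **Given the modularity theorem, the level of a datum is the conductor** for every `W`
(`IsNewformOf.level_eq_conductorNorm_of_exists_isNewformOf`: a newform at level `N_W` pins the level
of every newform of `W`; Diamond–Shurman Thm. 8.8.1). [cite: DiamondShurman2005, Thm. 8.8.1] -/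
theorem level_eq_conductorNorm_of_exists (h : exists_isNewformOf)
    (D : ModularParametrizationData W N) : N = W.conductorNorm ℤ := by
  haveI := D.isElliptic
  exact IsNewformOf.level_eq_conductorNorm_of_exists_isNewformOf h D.isNewformOf

end ModularParametrizationData

/-! ### The census: `Nonempty` / `IsEmpty` regions -/

section Census

/-- **Inhabited iff elliptic and modular at level `N`** (unconditional): a datum yields `W.IsElliptic`
and its newform; conversely the newform alone yields a datum (the tree's construction
`nonempty_modularParametrizationData_of_isNewformOf`). [cite: BCDTJAMS2001, p. 845, (2) ⇔ (6)] -/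
theorem ModularParametrizationData_nonempty_iff (W : WeierstrassCurve ℚ) (N : ℕ) [NeZero N] :
    Nonempty (ModularParametrizationData W N) ↔
      ∃ _ : W.IsElliptic, ∃ f : CuspForm (Gamma0 N) 2, IsNewformOf W f :=
  ⟨fun ⟨D⟩ ↦ ⟨D.isElliptic, D.f, D.isNewformOf⟩, fun ⟨_, _, hf⟩ ↦
    Literature.NumberTheory.Automorphic.nonempty_modularParametrizationData_of_isNewformOf hf⟩

/-- **Singular curves carry no datum** (any level): `IsEmpty (ModularParametrizationData W N)` if
`W` is not elliptic (`ModularParametrizationData.isElliptic`). [cite: SilvermanAEC2009, III.1] -/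
theorem ModularParametrizationData_isEmpty_of_not_isElliptic (W : WeierstrassCurve ℚ) (N : ℕ)
    [NeZero N] (h : ¬ W.IsElliptic) : IsEmpty (ModularParametrizationData W N) :=
  ⟨fun D ↦ h D.isElliptic⟩

/-- **`Δ(W) = 0` ⇒ no datum** (any level). [cite: SilvermanAEC2009, III.1] -/
theorem ModularParametrizationData_isEmpty_of_Δ_eq_zero (W : WeierstrassCurve ℚ) (N : ℕ) [NeZero N]
    (h : W.Δ = 0) : IsEmpty (ModularParametrizationData W N) :=
  ModularParametrizationData_isEmpty_of_not_isElliptic W N fun hE ↦ hE.isUnit.ne_zero h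

/-- **Genus zero ⇒ no datum** (every `W`): `IsEmpty (ModularParametrizationData W N)` whenever
`g(X₀(N)) = 0`, since then `S₂(Γ₀(N)) = 0` (`finrank_cuspForm_two_eq_genusX0_holds`,
Diamond–Shurman Thm. 3.5.1) has no normalised element. [cite: DiamondShurman2005, Thm. 3.5.1] -/
theorem ModularParametrizationData_isEmpty_of_genusX0_eq_zero (W : WeierstrassCurve ℚ) (N : ℕ)
    [NeZero N] (hg : genusX0 N = 0) : IsEmpty (ModularParametrizationData W N) :=
  ⟨fun D ↦ D.genusX0_ne_zero hg⟩

/-- The fifteen genus-zero levels: `g(X₀(N)) = 0` for `N ∈ {1, …, 10, 12, 13, 16, 18, 25}`, from the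
tree's numerical data `gamma0_data_N` (`μ`, `ν_∞`, `ν₂`, `ν₃`) in the closed formula `genusX0`
(Diamond–Shurman Thm. 3.1.1 with Figure 3.3). [cite: DiamondShurman2005, Thm. 3.1.1] -/
theorem genusX0_eq_zero_of_mem_genusZeroLevels {N : ℕ}
    (hN : N ∈ ({1, 2, 3, 4, 5, 6, 7, 8, 9, 10, 12, 13, 16, 18, 25} : Finset ℕ)) : genusX0 N = 0 := by
  simp only [Finset.mem_insert, Finset.mem_singleton] at hN
  rcases hN with rfl | rfl | rfl | rfl | rfl | rfl | rfl | rfl | rfl | rfl | rfl | rfl | rfl |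
    rfl | rfl
  · obtain ⟨hμ, hν, h₂, h₃⟩ := gamma0_data_1; rw [genusX0, hμ, hν, h₂, h₃]
  · obtain ⟨hμ, hν, h₂, h₃⟩ := gamma0_data_2; rw [genusX0, hμ, hν, h₂, h₃]
  · obtain ⟨hμ, hν, h₂, h₃⟩ := gamma0_data_3; rw [genusX0, hμ, hν, h₂, h₃]
  · obtain ⟨hμ, hν, h₂, h₃⟩ := gamma0_data_4; rw [genusX0, hμ, hν, h₂, h₃]
  · obtain ⟨hμ, hν, h₂, h₃⟩ := gamma0_data_5; rw [genusX0, hμ, hν, h₂, h₃]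
  · obtain ⟨hμ, hν, h₂, h₃⟩ := gamma0_data_6; rw [genusX0, hμ, hν, h₂, h₃]
  · obtain ⟨hμ, hν, h₂, h₃⟩ := gamma0_data_7; rw [genusX0, hμ, hν, h₂, h₃]
  · obtain ⟨hμ, hν, h₂, h₃⟩ := gamma0_data_8; rw [genusX0, hμ, hν, h₂, h₃]
  · obtain ⟨hμ, hν, h₂, h₃⟩ := gamma0_data_9; rw [genusX0, hμ, hν, h₂, h₃]
  · obtain ⟨hμ, hν, h₂, h₃⟩ := gamma0_data_10; rw [genusX0, hμ, hν, h₂, h₃]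
  · obtain ⟨hμ, hν, h₂, h₃⟩ := gamma0_data_12; rw [genusX0, hμ, hν, h₂, h₃]
  · obtain ⟨hμ, hν, h₂, h₃⟩ := gamma0_data_13; rw [genusX0, hμ, hν, h₂, h₃]
  · obtain ⟨hμ, hν, h₂, h₃⟩ := gamma0_data_16; rw [genusX0, hμ, hν, h₂, h₃]
  · obtain ⟨hμ, hν, h₂, h₃⟩ := gamma0_data_18; rw [genusX0, hμ, hν, h₂, h₃]
  · obtain ⟨hμ, hν, h₂, h₃⟩ := gamma0_data_25; rw [genusX0, hμ, hν, h₂, h₃]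

/-- **The fifteen genus-zero levels carry no datum, for any `W`**: `IsEmpty` for
`N ∈ {1, …, 10, 12, 13, 16, 18, 25}` (the curves `X₀(N)` of genus `0`, Diamond–Shurman Thm. 3.5.1 with
Figure 3.3); every item `∀ D : ModularParametrizationData W N, …` is vacuous there — as it must be, no
elliptic curve over `ℚ` having such a conductor. [cite: DiamondShurman2005, Thm. 3.5.1] -/
theorem ModularParametrizationData_isEmpty_of_mem_genusZeroLevels (W : WeierstrassCurve ℚ) (N : ℕ)
    [NeZero N] (hN : N ∈ ({1, 2, 3, 4, 5, 6, 7, 8, 9, 10, 12, 13, 16, 18, 25} : Finset ℕ)) :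
    IsEmpty (ModularParametrizationData W N) :=
  ModularParametrizationData_isEmpty_of_genusX0_eq_zero W N (genusX0_eq_zero_of_mem_genusZeroLevels hN)

/-- **Wrong prime support ⇒ no datum**: if `N.primeFactors ≠ N_W.primeFactors` then
`IsEmpty (ModularParametrizationData W N)` (`ModularParametrizationData.primeFactors_level_eq`).
[cite: DiamondShurman2005, Prop. 5.8.5 and (8.44)] -/
theorem ModularParametrizationData_isEmpty_of_primeFactors_ne (W : WeierstrassCurve ℚ) (N : ℕ)
    [NeZero N] (h : N.primeFactors ≠ (W.conductorNorm ℤ).primeFactors) :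
    IsEmpty (ModularParametrizationData W N) :=
  ⟨fun D ↦ h D.primeFactors_level_eq⟩

/-- **Semistable curve, level `≠` conductor ⇒ no datum** (unconditional):
`Squarefree N_W → N_W ≠ N → IsEmpty (ModularParametrizationData W N)`
(`ModularParametrizationData.level_eq_conductorNorm_of_squarefree`). [cite: AtkinLehner1970, Thm. 3] -/
theorem ModularParametrizationData_isEmpty_of_squarefree_of_ne (W : WeierstrassCurve ℚ) (N : ℕ)
    [NeZero N] (hsq : Squarefree (W.conductorNorm ℤ)) (hN : W.conductorNorm ℤ ≠ N) :
    IsEmpty (ModularParametrizationData W N) :=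
  ⟨fun D ↦ hN (D.level_eq_conductorNorm_of_squarefree hsq).symm⟩

/-- **At most one inhabited level per curve**: `Nonempty` at levels `N` and `N'` forces `N = N'`
(`ModularParametrizationData.level_eq_level`). [cite: AtkinLehner1970, Thm. 4] -/
theorem ModularParametrizationData_level_unique (W : WeierstrassCurve ℚ) {N N' : ℕ} [NeZero N]
    [NeZero N'] (h : Nonempty (ModularParametrizationData W N))
    (h' : Nonempty (ModularParametrizationData W N')) : N = N' := by
  obtain ⟨D⟩ := h
  obtain ⟨D'⟩ := h'
  exact D.level_eq_level D'

/-! ### Given the modularity theorem (`exists_isNewformOf`, an existing named fact of the tree) -/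

/-- **Every elliptic curve carries a datum at its conductor level, given the modularity theorem**
(the tree's named fact `exists_isNewformOf`, BCDT 2001 Thm. A as Diamond–Shurman Thm. 8.8.3: a newform
`f ∈ S₂(Γ₀(N_E))` with `aₙ(f) = aₙ(E)`): for elliptic `W/ℚ` and `N = N_W`, `Nonempty` by the tree's
THEOREM `nonempty_modularParametrizationData_of_isNewformOf` (no global minimality needed) — the
antecedent shape of the `ABC` route items. [cite: BCDTJAMS2001, Thm. A] [cite: DiamondShurman2005, Thm. 8.8.3] -/
theorem ModularParametrizationData_nonempty_of_exists (h : exists_isNewformOf) (W : WeierstrassCurve ℚ)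
    [W.IsElliptic] (N : ℕ) [NeZero N] (hN : W.conductorNorm ℤ = N) :
    Nonempty (ModularParametrizationData W N) := by
  subst hN
  obtain ⟨f, hf⟩ := h W
  exact Literature.NumberTheory.Automorphic.nonempty_modularParametrizationData_of_isNewformOf hf

/-- **Given modularity, no datum off the conductor level**: `N_W ≠ N → IsEmpty` for every `W`
(Carayol's level theorem over the tree, Diamond–Shurman Thm. 8.8.1). [cite: DiamondShurman2005, Thm. 8.8.1] -/
theorem ModularParametrizationData_isEmpty_of_exists_of_ne (h : exists_isNewformOf)
    (W : WeierstrassCurve ℚ) (N : ℕ) [NeZero N] (hN : W.conductorNorm ℤ ≠ N) :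
    IsEmpty (ModularParametrizationData W N) :=
  ⟨fun D ↦ hN (D.level_eq_conductorNorm_of_exists h).symm⟩

/-- **Given modularity, the carrier is decided exactly**:
`Nonempty (ModularParametrizationData W N) ↔ W.IsElliptic ∧ N_W = N`.
[cite: BCDTJAMS2001, Thm. A] [cite: DiamondShurman2005, Thm. 8.8.1] -/
theorem ModularParametrizationData_nonempty_iff_of_exists (h : exists_isNewformOf)
    (W : WeierstrassCurve ℚ) (N : ℕ) [NeZero N] :
    Nonempty (ModularParametrizationData W N) ↔ ∃ _ : W.IsElliptic, W.conductorNorm ℤ = N := by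
  refine ⟨fun ⟨D⟩ ↦ ⟨D.isElliptic, (D.level_eq_conductorNorm_of_exists h).symm⟩, ?_⟩
  rintro ⟨hE, hN⟩
  exact ModularParametrizationData_nonempty_of_exists h W N hN

/-! ### From Conrad–Diamond–Taylor 1999, Thm. 7.1.2 (`27 ∤ N_E`); Frey curves -/

/-- **A datum at the conductor level of every elliptic curve with `27 ∤ N_E`, given CDT 1999
Thm. 7.1.2** (the tree's named fact `BCDT.CDT_theorem_7_1_2`). [cite: ConradDiamondTaylor1999, Thm. 7.1.2] -/
theorem ModularParametrizationData_nonempty_of_CDT712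
    (h712 : Literature.NumberTheory.Automorphic.BCDT.CDT_theorem_7_1_2) (W : WeierstrassCurve ℚ)
    [W.IsElliptic] (h27 : ¬ 27 ∣ W.conductorNorm ℤ) (N : ℕ) [NeZero N] (hN : W.conductorNorm ℤ = N) :
    Nonempty (ModularParametrizationData W N) := by
  subst hN
  obtain ⟨f, hf⟩ := h712 W h27
  exact Literature.NumberTheory.Automorphic.nonempty_modularParametrizationData_of_isNewformOf hf

/-- **Every non-degenerate Frey curve carries a datum at its conductor level, given CDT 1999
Thm. 7.1.2**: for coprime `a, b` with `ab(a+b) ≠ 0` (`E_(a,b)` elliptic) and `N = N_{E_(a,b)}` —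
verbatim the antecedent shape of the `DefiniteXi` items. Here `27 ∤ N`, indeed `9 ∤ N`:
`N_{E_(a,b)} ∣ 2⁸ · rad(ab(a+b))` (`conductorNorm_freyCurve_dvd_holds`; Bombieri–Gubler Ex. 12.5.10,
semistable at every odd prime) with a squarefree radical. [cite: ConradDiamondTaylor1999, Thm. 7.1.2]
[cite: BombieriGubler2006, Ex. 12.5.10] -/
theorem ModularParametrizationData_freyCurve_nonempty_of_CDT712
    (h712 : Literature.NumberTheory.Automorphic.BCDT.CDT_theorem_7_1_2) {a b : ℤ}
    (hab : IsCoprime a b) (h0 : a * b * (a + b) ≠ 0) (N : ℕ) [NeZero N]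
    (hN : (freyCurve a b).conductorNorm ℤ = N) :
    Nonempty (ModularParametrizationData (freyCurve a b) N) := by
  haveI := isElliptic_freyCurve h0
  refine ModularParametrizationData_nonempty_of_CDT712 h712 (freyCurve a b) (fun h27 ↦ ?_) N hN
  -- `9 ∣ 27 ∣ N ∣ 2⁸ · rad(ab(a+b))`, and the radical is squarefree
  have h9 : 9 ∣ 2 ^ 8 * (UniqueFactorizationMonoid.radical (a * b * (a + b))).natAbs :=
    ((show (9 : ℕ) ∣ 27 by norm_num).trans h27).trans (conductorNorm_freyCurve_dvd_holds a b hab h0)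
  have h9r : 9 ∣ (UniqueFactorizationMonoid.radical (a * b * (a + b))).natAbs :=
    (show Nat.Coprime 9 (2 ^ 8) by norm_num).dvd_of_dvd_mul_left h9
  have hsq : Squarefree (UniqueFactorizationMonoid.radical (a * b * (a + b))).natAbs :=
    Int.squarefree_natAbs.mpr UniqueFactorizationMonoid.squarefree_radical
  have h3 : IsUnit (3 : ℕ) := hsq 3 ((show (3 : ℕ) * 3 = 9 by norm_num) ▸ h9r)
  exact absurd (Nat.isUnit_iff.mp h3) (by norm_num)

/-- **Degenerate Frey triples carry no datum at any level**: if `ab(a+b) = 0` then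
`Δ(E_(a,b)) = 16 (ab(a+b))² = 0` (`freyCurve_Δ`), so `IsEmpty (ModularParametrizationData (freyCurve a b) N)`
for every `N`. [cite: SilvermanAEC2009, III.1] -/
theorem ModularParametrizationData_freyCurve_isEmpty_of_eq_zero {a b : ℤ} (h0 : a * b * (a + b) = 0)
    (N : ℕ) [NeZero N] : IsEmpty (ModularParametrizationData (freyCurve a b) N) := by
  refine ModularParametrizationData_isEmpty_of_Δ_eq_zero _ N ?_
  rw [freyCurve_Δ]
  have : ((a * b * (a + b) : ℤ) : ℚ) = 0 := by exact_mod_cast h0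
  push_cast at this
  rw [this]
  norm_num

/-! ### An unconditional inhabitant: `E₁ : y² = x³ − x` at level `32` (`X₀(32) = E₁`) -/

open Literature.NumberTheory.EllipticCurves.Tunnell1983 in
/-- **The carrier is inhabited, unconditionally, at `(E₁, 32)`.** The congruent number curve
`E₁ : y² = x³ − x` is modular with newform `φ = η(4z)²η(8z)² ∈ S₂(Γ₀(32))` — the tree's THEOREM
`Tunnell1983.isNewformOf_congruentNumberCurve_one` (`aₙ(φ) = aₙ(E₁)` by Jacobi sums; `φ` new and eigen
as `dim S₂(Γ₀(32)) = 1`; Darmon–Merel §4: "`X₀(32) : Y² = X³ − X`") — so the tree's construction yields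
a datum; classically the identity parametrisation `X₀(32) = E₁`. [cite: Tunnell1983Congruent, p. 325]
[cite: DarmonMerel1997, §4 (first paragraph)] -/
theorem ModularParametrizationData_nonempty_congruentNumberCurve_one :
    Nonempty (ModularParametrizationData (congruentNumberCurve 1) 32) :=
  haveI := isElliptic_congruentNumberCurve_one
  Literature.NumberTheory.Automorphic.nonempty_modularParametrizationData_of_isNewformOf
    isNewformOf_congruentNumberCurve_one

/-- **At `E₁` the carrier is decided at every level, unconditionally**: `Nonempty ↔ N = 32` (a datum
at level `N` forces `N = 32` by `ModularParametrizationData.level_eq_level`). [cite: AtkinLehner1970, Thm. 4] -/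
theorem ModularParametrizationData_nonempty_congruentNumberCurve_one_iff (N : ℕ) [NeZero N] :
    Nonempty (ModularParametrizationData (congruentNumberCurve 1) N) ↔ N = 32 := by
  refine ⟨fun ⟨D⟩ ↦ ?_, ?_⟩
  · obtain ⟨D₃₂⟩ := ModularParametrizationData_nonempty_congruentNumberCurve_one
    exact D.level_eq_level D₃₂
  · rintro rfl
    exact ModularParametrizationData_nonempty_congruentNumberCurve_one

open Literature.NumberTheory.EllipticCurves.Tunnell1983 in
/-- **The route's example domain is inhabited, unconditionally**:
`Nonempty (ModularParametrizationData (freyCurve 1 1) 32)` — for `E_(1,1)` IS `E₁` on the nose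
(`y² = x(x − 1)(x + 1) = x³ − x`: `a₂ = b − a = 0`, `a₄ = −ab = −1`). [cite: Tunnell1983Congruent, p. 325] -/
theorem ModularParametrizationData_nonempty_freyCurve_one_one :
    Nonempty (ModularParametrizationData (freyCurve 1 1) 32) := by
  rw [show freyCurve 1 1 = congruentNumberCurve 1 by ext <;> simp [freyCurve, congruentNumberCurve]]
  exact ModularParametrizationData_nonempty_congruentNumberCurve_one

open Literature.NumberTheory.EllipticCurves.Tunnell1983 in
/-- **Verbatim the antecedent of the `DefiniteXi` items, witnessed unconditionally at `(a, b) = (1, 1)`**: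
`IsCoprime 1 1`, `1 · 1 · (1 + 1) ≠ 0`, and `ModularParametrizationData (freyCurve 1 1) N` is inhabited
for every `N` with `(freyCurve 1 1).conductorNorm ℤ = N` (that is `N = 32 = N(E₁)`,
`Tunnell1983.conductorNorm_congruentNumberCurve_one`: Tate's algorithm at `2`, type `III`) — so no item
`∀ a b, IsCoprime a b → ab(a+b) ≠ 0 → ∀ N, N_{E_(a,b)} = N → ∀ D, …` is vacuous.
[cite: Tunnell1983Congruent, p. 325] [cite: DarmonMerel1997, Prop. 1.1 (1)] -/
theorem ModularParametrizationData_nonempty_freyCurve_one_one_of_eq :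
    IsCoprime (1 : ℤ) 1 ∧ (1 : ℤ) * 1 * (1 + 1) ≠ 0 ∧
      ∀ (N : ℕ) [NeZero N], (freyCurve 1 1).conductorNorm ℤ = N →
        Nonempty (ModularParametrizationData (freyCurve 1 1) N) := by
  refine ⟨isCoprime_one_left, by norm_num, fun N _ hN ↦ ?_⟩
  have h32 : (freyCurve 1 1).conductorNorm ℤ = 32 := by
    rw [show freyCurve 1 1 = congruentNumberCurve 1 by ext <;> simp [freyCurve, congruentNumberCurve]]
    exact conductorNorm_congruentNumberCurve_one
  rw [h32] at hN
  subst hN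
  exact ModularParametrizationData_nonempty_freyCurve_one_one

/-- **The census' existential view** (`∃ params, Nonempty (C params)`): `ModularParametrizationData`
is inhabited at some parameters, unconditionally — `(E₁, 32)`. [cite: Tunnell1983Congruent, p. 325] -/
theorem ModularParametrizationData_nonempty_some :
    ∃ (W : WeierstrassCurve ℚ) (N : ℕ) (_ : NeZero N), Nonempty (ModularParametrizationData W N) :=
  ⟨congruentNumberCurve 1, 32, inferInstance,
    ModularParametrizationData_nonempty_congruentNumberCurve_one⟩

/-- **… and empty at others** (`∃ params, IsEmpty (C params)`), unconditionally — e.g. `(E₁, 1)`.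
[cite: DiamondShurman2005, Thm. 3.5.2] -/
theorem ModularParametrizationData_isEmpty_some :
    ∃ (W : WeierstrassCurve ℚ) (N : ℕ) (_ : NeZero N), IsEmpty (ModularParametrizationData W N) :=
  ⟨congruentNumberCurve 1, 1, inferInstance,
    ModularParametrizationData_isEmpty_of_mem_genusZeroLevels _ 1 (by simp)⟩

/-! ### Instances (unconditional `Nonempty`, for instance search / the census probe) -/

/-- `Nonempty (ModularParametrizationData E₁ 32)` registered as an instance (the theorem
`ModularParametrizationData_nonempty_congruentNumberCurve_one`; unconditional). [cite: Tunnell1983Congruent, p. 325] -/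
instance ModularParametrizationData.instNonemptyCongruentNumberCurveOne :
    Nonempty (ModularParametrizationData (congruentNumberCurve 1) 32) :=
  ModularParametrizationData_nonempty_congruentNumberCurve_one

/-- `Nonempty (ModularParametrizationData (freyCurve 1 1) 32)` registered as an instance (the theorem
`ModularParametrizationData_nonempty_freyCurve_one_one`; unconditional). [cite: Tunnell1983Congruent, p. 325] -/
instance ModularParametrizationData.instNonemptyFreyCurveOneOne :
    Nonempty (ModularParametrizationData (freyCurve 1 1) 32) :=
  ModularParametrizationData_nonempty_freyCurve_one_one

end Census

end Literature.NumberTheory.EllipticCurves.ModularForms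

end
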